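import Literature.MathematicalPhysics.QuantumManyBody.ScatteringLengthTailRegularization
import Literature.MathematicalPhysics.QuantumManyBody.ScatteringLengthTruncation
import Literature.MathematicalPhysics.QuantumManyBody.HardCoreScatteringLength
import HarnessLib

/-!
# Replacement of a hard-core potential by an integrable one (FGJMOT Prop. 2.1) — preliminaries

Topic `Literature/MathematicalPhysics/QuantumManyBody`, namespace `BoseGas` (provefact
`Literature.MathematicalPhysics.QuantumManyBody.BoseGas.Junge2026_neumannBox_pinnedLowerBound`; brick:
[FournaisEtAl2024, Prop. 2.1 and its proof, §3 (3.10)–(3.14)]). This file assembles the inputs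
of the proof of Prop. 2.1 in the form in which they are used there:

* `scatteringLength_congr_off_sphere` — the variational scattering length ignores the values of
  the profile at a single positive radius (a sphere is Lebesgue-null);
* `FournaisEtAl2024_lemma33_antitone` — **Lemma 3.3 for a radially non-increasing `V`** (hard
  core allowed): `a(V) ≤ a(min(V,K)) + √(2/K)`; the ball `{V > K}` is produced from the monotonicity
  (`R_K = sup{r > 0 : V(r) > K}`, the value at `r = R_K` being immaterial), and
  `FournaisEtAl2024_lemma33_core` applies;
* `FournaisEtAl2024_lemma34_radius` — **Lemma 3.4 at a prescribed cut radius**: for every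
  `0 < ρ < R₀` with positive tail mass `m(ρ) = ∫_ρ^{R₀} ½ws²`,
  `a(w·1_{(ρ,∞)}) ≥ a(w) - 2a(w)²/m(ρ)` (the two regimes of `ScatteringLengthTailRegularization`);
* `squareWell_shell_odeScatteringLength_ge` — the estimate of the proof of Prop. 2.1 for the
  auxiliary shell potential `v₀ = K₀·1_{(ρ₁, x₀]}` ((3.13)–(3.14): "we use Lemma 3.3 with
  `K = v(x₀)` to cut the hard-core potential, and then compare the resulting potential to `v₀`
  using Lemma 3.4"): `x₀ - a(v₀) ≤ √(2/K₀) + 12x₀²/(K₀(x₀³ - ρ₁³))`.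

No definitions.

## References

* [FournaisEtAl2024] S. Fournais, L. Junge, T. Girardot, L. Morin, M. Olivieri, A. Triay, *The free
  energy of dilute Bose gases at low temperatures interacting via strong potentials*,
  arXiv:2408.14222, Ann. Henri Poincaré (2026): Prop. 2.1, §3, Lemmas 3.3–3.4, (3.10)–(3.14).
* [FournaisSolovej2022] S. Fournais, J. P. Solovej, *The energy of dilute Bose gases II*, Invent.
  Math. 232 (2023), arXiv:2108.12022: Lemma 3.2.
* [LSSY2005] Lieb–Seiringer–Solovej–Yngvason, *The Mathematics of the Bose Gas and its
  Condensation*, 2005: App. C.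
-/

noncomputable section

open MeasureTheory Set Filter Topology Metric
open scoped ENNReal NNReal

namespace Literature.MathematicalPhysics.QuantumManyBody.BoseGas

/-! ### The scattering length ignores a sphere -/

section Sphere

/-- **Profiles agreeing off one positive radius have the same scattering length** (the sphere
`{|x| = ρ}` and the origin are Lebesgue-null in `ℝ³`). [folklore] -/
theorem scatteringLength_congr_off_sphere {v₁ v₂ : ℝ → ℝ≥0∞} {ρ : ℝ}
    (h : ∀ r, 0 < r → r ≠ ρ → v₁ r = v₂ r) : scatteringLength v₁ = scatteringLength v₂ := by
  have key : ∀ φ : Space → ℝ, scatteringFunctional v₁ φ = scatteringFunctional v₂ φ := by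
    intro φ
    refine lintegral_congr_ae ?_
    have hnull : volume ({0} ∪ sphere (0 : Space) ρ) = 0 := by
      rw [measure_union_null_iff]
      exact ⟨measure_singleton _, Measure.addHaar_sphere volume _ _⟩
    have hae : ∀ᵐ x : Space, x ∉ ({0} ∪ sphere (0 : Space) ρ) := by
      rw [ae_iff]
      exact measure_mono_null (fun x hx => not_not.1 hx) hnull
    filter_upwards [hae] with x hx
    simp only [mem_union, mem_singleton_iff, mem_sphere, dist_zero_right, not_or] at hx
    rw [h _ (norm_pos_iff.2 hx.1) hx.2]
  unfold scatteringLength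
  simp_rw [key]

end Sphere

/-! ### Lemma 3.3 for a non-increasing potential -/

section Lemma33Antitone

variable {V : ℝ → ℝ≥0∞} {K R₀ : ℝ}

/-- **FGJMOT Lemma 3.3 for a radially non-increasing potential** (hard core allowed): if `V` is
measurable, non-increasing on `(0, ∞)` and vanishes beyond `R₀`, then for every `K > 0`,
`a(V) ≤ a(min(V, K)) + √(2/K)` ("using that `V` is decreasing, we get `{V > K} = B(0, R_K)` for some
`R_K ≥ 0`"; the printed bound is `2√2/√K`). [cite: FournaisEtAl2024, Lemma 3.3] -/
theorem FournaisEtAl2024_lemma33_antitone (hV : Measurable V) (hanti : AntitoneOn V (Ioi 0))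
    (hR₀ : ∀ s, R₀ < s → V s = 0) (hK : 0 < K) :
    scatteringLength V ≤
      scatteringLength (fun r => min (V r) (ENNReal.ofReal K)) + ENNReal.ofReal (Real.sqrt (2 / K)) := by
  set S : Set ℝ := {r | 0 < r ∧ ENNReal.ofReal K < V r} with hS
  by_cases hSe : S = ∅
  · -- `V ≤ K` on `(0, ∞)`: nothing is cut
    have hle : ∀ r, 0 < r → V r ≤ ENNReal.ofReal K := fun r hr => by
      by_contra h
      have : r ∈ S := ⟨hr, not_le.1 h⟩
      rw [hSe] at this; exact this
    rw [scatteringLength_congr_Ioi (v₂ := fun r => min (V r) (ENNReal.ofReal K))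
      fun r hr => (min_eq_left (hle r hr)).symm]
    exact le_self_add
  -- the radius `R_K = sup S ∈ (0, R₀]`
  have hSne : S.Nonempty := nonempty_iff_ne_empty.2 hSe
  have hSbdd : BddAbove S := ⟨R₀, fun r hr => by
    by_contra h
    have hr2 : ENNReal.ofReal K < V r := hr.2
    rw [hR₀ r (not_le.1 h)] at hr2
    exact absurd hr2 (not_lt.2 zero_le)⟩
  set RK : ℝ := sSup S with hRK
  obtain ⟨r₁, hr₁S⟩ := hSne
  have hRKpos : 0 < RK := hr₁S.1.trans_le (le_csSup hSbdd hr₁S)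
  have hRKR₀ : RK ≤ R₀ := csSup_le ⟨r₁, hr₁S⟩ fun r hr => by
    by_contra h
    have hr2 : ENNReal.ofReal K < V r := hr.2
    rw [hR₀ r (not_le.1 h)] at hr2
    exact absurd hr2 (not_lt.2 zero_le)
  have hR₀pos : 0 < R₀ := hRKpos.trans_le hRKR₀
  -- modify `V` at the single radius `R_K`
  set V' : ℝ → ℝ≥0∞ := fun r => if r = RK then max (V RK) (ENNReal.ofReal K) else V r with hV'
  have hmV' : Measurable V' := Measurable.ite (measurableSet_singleton RK) measurable_const hV
  have hagree : ∀ r, 0 < r → r ≠ RK → V r = V' r := fun r _ hr => by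
    rw [hV']; dsimp only; rw [if_neg hr]
  have hR₀' : ∀ s, R₀ < s → V' s = 0 := fun s hs => by
    have hs' : s ≠ RK := by intro h; rw [h] at hs; linarith
    rw [← hagree s (hR₀pos.trans hs) hs']; exact hR₀ s hs
  have hlow : ∀ r, 0 < r → r ≤ RK → ENNReal.ofReal K ≤ V' r := by
    intro r hr hrK
    rcases eq_or_lt_of_le hrK with h | h
    · rw [hV']; dsimp only; rw [if_pos h]; exact le_max_right _ _
    · obtain ⟨s, hsS, hrs⟩ := exists_lt_of_lt_csSup ⟨r₁, hr₁S⟩ h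
      rw [← hagree r hr h.ne]
      exact hsS.2.le.trans (hanti hr hsS.1 hrs.le)
  have hhigh : ∀ r, RK < r → V' r ≤ ENNReal.ofReal K := by
    intro r hr
    rw [← hagree r (hRKpos.trans hr) hr.ne']
    by_contra h
    have hrS : r ∈ S := ⟨hRKpos.trans hr, not_le.1 h⟩
    exact absurd (le_csSup hSbdd hrS) (not_le.2 hr)
  have h33 := FournaisEtAl2024_lemma33_core hmV' hR₀' hK hRKpos hRKR₀ hlow hhigh
  rw [scatteringLength_congr_off_sphere (ρ := RK) hagree,
    scatteringLength_congr_off_sphere (ρ := RK) (v₁ := fun r => min (V r) (ENNReal.ofReal K))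
      (v₂ := fun r => min (V' r) (ENNReal.ofReal K)) fun r hr hne => by simp only [hagree r hr hne]]
  exact h33

/-- Real form. [cite: FournaisEtAl2024, Lemma 3.3] -/
theorem FournaisEtAl2024_lemma33_antitone_toReal (hV : Measurable V) (hanti : AntitoneOn V (Ioi 0))
    (hR₀ : ∀ s, R₀ < s → V s = 0) (hK : 0 < K) :
    (scatteringLength V).toReal - (scatteringLength fun r => min (V r) (ENNReal.ofReal K)).toReal ≤
      Real.sqrt (2 / K) := by
  have h := FournaisEtAl2024_lemma33_antitone hV hanti hR₀ hK
  have hfinV : scatteringLength V ≠ ⊤ := scatteringLength_ne_top_of_finiteRange hR₀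
  have hfin : scatteringLength (fun r => min (V r) (ENNReal.ofReal K)) ≠ ⊤ :=
    ne_top_of_le_ne_top hfinV (scatteringLength_mono fun _ => min_le_left _ _)
  have h' := (ENNReal.toReal_le_toReal hfinV (ENNReal.add_ne_top.2 ⟨hfin, ENNReal.ofReal_ne_top⟩)).2 h
  rw [ENNReal.toReal_add hfin ENNReal.ofReal_ne_top, ENNReal.toReal_ofReal (Real.sqrt_nonneg _)] at h'
  linarith

end Lemma33Antitone

/-! ### Lemma 3.4 at a prescribed cut radius -/

section Lemma34Radius

variable {w : ℝ → ℝ≥0∞} {M R₀ ρ : ℝ}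

/-- **Lemma 3.4 at a given cut radius**: for `0 < ρ < R₀` with tail mass
`m(ρ) = ∫_ρ^{R₀} ½w(s)s² ds > 0`, the tail `w·1_{(ρ,∞)}` has `a(w·1_{(ρ,∞)}) ≥ a(w) - 2a(w)²/m(ρ)`
(the bound of `FournaisEtAl2024_lemma34` with `S = m(ρ)/a(w)`).
[cite: FournaisEtAl2024, Lemma 3.4; FournaisSolovej2022, Lemma 3.2] -/
theorem FournaisEtAl2024_lemma34_radius (hw : Measurable w) (hM : ∀ r, w r ≤ ENNReal.ofReal M)
    (hM0 : 0 ≤ M) (hR₀ : 0 < R₀) (hwR₀ : ∀ s, R₀ < s → w s = 0) (ha : 0 < odeScatteringLength w R₀)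
    (hρ : 0 < ρ) (hρR : ρ < R₀) (hm : 0 < ∫ s in Ioc ρ R₀, (w s).toReal / 2 * s ^ 2) :
    odeScatteringLength w R₀ - 2 * odeScatteringLength w R₀ ^ 2 / (∫ s in Ioc ρ R₀, (w s).toReal / 2 * s ^ 2) ≤
      odeScatteringLength ((Ioi ρ).indicator w) R₀ := by
  set a : ℝ := odeScatteringLength w R₀ with ha_def
  set m : ℝ := ∫ s in Ioc ρ R₀, (w s).toReal / 2 * s ^ 2 with hm_def
  -- the tail potential
  set wS : ℝ → ℝ≥0∞ := (Ioi ρ).indicator w with hwS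
  have hmS : Measurable wS := hw.indicator measurableSet_Ioi
  have hbS : ∀ r, wS r ≤ ENNReal.ofReal M := fun r => by
    rw [hwS]; by_cases h : r ∈ Ioi ρ
    · rw [indicator_of_mem h]; exact hM r
    · rw [indicator_of_notMem h]; exact zero_le
  have hSle : ∀ r, wS r ≤ w r := fun r => indicator_le_self _ _ r
  have hSR₀ : ∀ s, R₀ < s → wS s = 0 := fun s hs => by
    rw [hwS]; by_cases h : s ∈ Ioi ρ
    · rw [indicator_of_mem h]; exact hwR₀ s hs
    · exact indicator_of_notMem h _
  have hSw : ∀ s, ρ < s → wS s = w s := fun s hs => indicator_of_mem (mem_Ioi.2 hs) _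
  set aS : ℝ := odeScatteringLength wS R₀ with haS
  have haS0 : 0 ≤ aS := odeScatteringLength_nonneg hmS hbS hM0 hR₀.le
  have haSa : aS ≤ a := odeScatteringLength_mono_pot hmS hw hbS hM hM0 hSle hR₀ hwR₀
  have hmS' : ∫ s in Ioc ρ R₀, (wS s).toReal / 2 * s ^ 2 = m :=
    setIntegral_congr_fun measurableSet_Ioc fun s hs => by rw [hSw s hs.1]
  -- `φ_S(ρ) m ≤ a_S` and `φ(ρ) m ≤ a`
  have hφS : radialProfile wS R₀ ρ * m ≤ aS := by
    rw [← hmS']; exact radialProfile_mul_tailMass_le hmS hbS hM0 hR₀ hSR₀ hρ.le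
  have hφ : radialProfile w R₀ ρ * m ≤ a := radialProfile_mul_tailMass_le hw hM hM0 hR₀ hwR₀ hρ.le
  suffices h : a ≤ aS + 2 * a ^ 2 / m by linarith
  rcases le_or_gt ρ (2 * a) with hρa | hρa
  · -- first regime
    have h1 := odeScatteringLength_le_tail_add hw hM hM0 hR₀ hwR₀ hρ hρR
    have hφS' : radialProfile wS R₀ ρ ≤ aS / m := (le_div_iff₀ hm).2 hφS
    have hφS0 : 0 ≤ radialProfile wS R₀ ρ := (radialProfile_pos hmS hbS hM0 R₀ ρ).le
    have h2 : ρ * radialProfile wS R₀ ρ ≤ 2 * a ^ 2 / m := by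
      calc ρ * radialProfile wS R₀ ρ ≤ 2 * a * (aS / m) := mul_le_mul hρa hφS' hφS0 (by linarith)
        _ = 2 * a * aS / m := by ring
        _ ≤ 2 * a * a / m := by gcongr
        _ = 2 * a ^ 2 / m := by ring
    linarith
  · -- second regime
    have h1 := odeScatteringLength_le_core_add_tail hw hM hM0 hR₀ hwR₀ hρ hρR
    set wL : ℝ → ℝ≥0∞ := (Iic ρ).indicator w with hwL
    have hmL : Measurable wL := hw.indicator measurableSet_Iic
    have hbL : ∀ r, wL r ≤ ENNReal.ofReal M := fun r => by
      rw [hwL]; by_cases h : r ∈ Iic ρ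
      · rw [indicator_of_mem h]; exact hM r
      · rw [indicator_of_notMem h]; exact zero_le
    have hLle : ∀ r, wL r ≤ w r := fun r => indicator_le_self _ _ r
    have hLρ : ∀ s, ρ < s → wL s = 0 := fun s hs =>
      indicator_of_notMem (show s ∉ Iic ρ from not_le.2 hs) _
    set aL : ℝ := odeScatteringLength wL ρ with haL
    have haL0 : 0 ≤ aL := odeScatteringLength_nonneg hmL hbL hM0 hρ.le
    have haLa : aL ≤ a := by
      rw [haL, ← odeScatteringLength_eq_of_le_of_le hmL hbL hM0 hρ.le hLρ hρR.le]
      exact odeScatteringLength_mono_pot hmL hw hbL hM hM0 hLle hR₀ hwR₀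
    have hφ' : radialProfile w R₀ ρ ≤ a / m := (le_div_iff₀ hm).2 hφ
    have hφ0 : 0 ≤ radialProfile w R₀ ρ := (radialProfile_pos hw hM hM0 R₀ ρ).le
    have hden : 1 / 2 ≤ 1 - aL / ρ := by
      have : aL / ρ ≤ 1 / 2 := by rw [div_le_iff₀ hρ]; linarith
      linarith
    have h2 : radialProfile w R₀ ρ * aL / (1 - aL / ρ) ≤ 2 * a ^ 2 / m := by
      rw [div_le_iff₀ (by linarith)]
      calc radialProfile w R₀ ρ * aL ≤ a / m * a := mul_le_mul hφ' haLa haL0 (by positivity)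
        _ = 2 * a ^ 2 / m * (1 / 2) := by ring
        _ ≤ 2 * a ^ 2 / m * (1 - aL / ρ) := mul_le_mul_of_nonneg_left hden (by positivity)
    linarith

end Lemma34Radius

/-! ### The auxiliary shell potential of the proof of Prop. 2.1 -/

section Shell

variable {K₀ ρ₁ x₀ : ℝ}

/-- The shell `K₀·1_{(ρ₁, x₀]}` is the tail, cut at `ρ₁`, of the well `K₀·1_{r ≤ x₀}`. [folklore] -/
theorem shell_eq_tail_well :
    (Ioc ρ₁ x₀).indicator (fun _ : ℝ => ENNReal.ofReal K₀) =
      (Ioi ρ₁).indicator ((Iic x₀).indicator fun _ : ℝ => ENNReal.ofReal K₀) := by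
  funext r
  by_cases h1 : ρ₁ < r
  · by_cases h2 : r ≤ x₀
    · rw [indicator_of_mem (show r ∈ Ioc ρ₁ x₀ from ⟨h1, h2⟩), indicator_of_mem (mem_Ioi.2 h1),
        indicator_of_mem (mem_Iic.2 h2)]
    · rw [indicator_of_notMem (show r ∉ Ioc ρ₁ x₀ from fun h => h2 h.2), indicator_of_mem (mem_Ioi.2 h1),
        indicator_of_notMem (show r ∉ Iic x₀ from h2)]
  · rw [indicator_of_notMem (show r ∉ Ioc ρ₁ x₀ from fun h => h1 h.1),
      indicator_of_notMem (show r ∉ Ioi ρ₁ from h1)]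

/-- **The scattering length of the shell `v₀ = K₀·1_{(ρ₁, x₀]}`** (`K₀ > 0`, `0 < ρ₁ < x₀`):
`x₀ - a(v₀) ≤ √(2/K₀) + 12x₀²/(K₀(x₀³ - ρ₁³))` — Lemma 3.3 for the well of height `K₀` against the
hard core of radius `x₀` (`x₀ - a_well ≤ √(2/K₀)`), then Lemma 3.4 at the cut radius `ρ₁` for the
well (tail mass `K₀(x₀³ - ρ₁³)/6`, `a_well ≤ x₀`). [cite: FournaisEtAl2024, Prop. 2.1, proof, (3.13)–(3.14)] -/
theorem squareWell_shell_odeScatteringLength_ge (hK₀ : 0 < K₀) (hρ₁ : 0 < ρ₁) (hx₀ : ρ₁ < x₀) :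
    x₀ - Real.sqrt (2 / K₀) - 12 * x₀ ^ 2 / (K₀ * (x₀ ^ 3 - ρ₁ ^ 3)) ≤
      odeScatteringLength ((Ioc ρ₁ x₀).indicator fun _ : ℝ => ENNReal.ofReal K₀) x₀ := by
  have hx₀pos : 0 < x₀ := hρ₁.trans hx₀
  set W : ℝ → ℝ≥0∞ := (Iic x₀).indicator fun _ : ℝ => ENNReal.ofReal K₀ with hW
  have hmW : Measurable W := measurable_squareWell K₀ x₀
  have hbW : ∀ r, W r ≤ ENNReal.ofReal K₀ := squareWell_le K₀ x₀
  have hWR : ∀ s, x₀ < s → W s = 0 := fun s hs => squareWell_eq_zero hs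
  set aw : ℝ := odeScatteringLength W x₀ with haw
  have haw_eq : aw = x₀ - Real.tanh (Real.sqrt (K₀ / 2) * x₀) / Real.sqrt (K₀ / 2) :=
    odeScatteringLength_squareWell hK₀ hx₀pos.le
  obtain ⟨_, haw1⟩ := sub_scatteringLength_squareWell_le hK₀ hx₀pos
  rw [← haw_eq] at haw1
  have haw_lt : aw < x₀ := odeScatteringLength_lt hmW hbW hK₀.le hx₀pos
  have haw0 : 0 ≤ aw := odeScatteringLength_nonneg hmW hbW hK₀.le hx₀pos.le
  -- the tail mass of the well from `ρ₁`
  have hmass : ∫ s in Ioc ρ₁ x₀, (W s).toReal / 2 * s ^ 2 = K₀ * (x₀ ^ 3 - ρ₁ ^ 3) / 6 := by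
    have h1 : ∫ s in Ioc ρ₁ x₀, (W s).toReal / 2 * s ^ 2 = ∫ s in Ioc ρ₁ x₀, K₀ / 2 * s ^ 2 := by
      refine setIntegral_congr_fun measurableSet_Ioc fun s hs => ?_
      rw [hW, indicator_of_mem (mem_Iic.2 hs.2), ENNReal.toReal_ofReal hK₀.le]
    rw [h1, ← intervalIntegral.integral_of_le hx₀.le, intervalIntegral.integral_const_mul,
      integral_pow]
    ring
  have hx3 : 0 < x₀ ^ 3 - ρ₁ ^ 3 := by
    have := pow_lt_pow_left₀ hx₀ hρ₁.le (by norm_num : (3 : ℕ) ≠ 0)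
    linarith
  have hm0 : 0 < ∫ s in Ioc ρ₁ x₀, (W s).toReal / 2 * s ^ 2 := by rw [hmass]; positivity
  rw [shell_eq_tail_well, ← hW]
  rcases eq_or_lt_of_le haw0 with haw00 | hawpos
  · -- `a_well = 0` cannot happen (`tanh t < t`), but the bound is trivial anyway
    have h0 : 0 ≤ odeScatteringLength ((Ioi ρ₁).indicator W) x₀ := by
      refine odeScatteringLength_nonneg (hmW.indicator measurableSet_Ioi) (fun r => ?_) hK₀.le hx₀pos.le
      exact (indicator_le_self _ _ r).trans (hbW r)
    have h1 : x₀ - Real.sqrt (2 / K₀) ≤ 0 := by linarith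
    have h2 : 0 ≤ 12 * x₀ ^ 2 / (K₀ * (x₀ ^ 3 - ρ₁ ^ 3)) := by positivity
    linarith
  have h34 := FournaisEtAl2024_lemma34_radius hmW hbW hK₀.le hx₀pos hWR hawpos hρ₁ hx₀ hm0
  rw [hmass] at h34
  have hbound : 2 * aw ^ 2 / (K₀ * (x₀ ^ 3 - ρ₁ ^ 3) / 6) ≤ 12 * x₀ ^ 2 / (K₀ * (x₀ ^ 3 - ρ₁ ^ 3)) := by
    rw [div_div_eq_mul_div]
    have : 2 * aw ^ 2 * 6 ≤ 12 * x₀ ^ 2 := by nlinarith [pow_le_pow_left₀ haw0 haw_lt.le 2]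
    exact div_le_div_of_nonneg_right this (by positivity)
  linarith

end Shell

/-! ### The pointwise bound on `g_S = w_S φ_S` -/

section PointwiseBound

variable {w : ℝ → ℝ≥0∞} {M R ρ : ℝ}

/-- The profile does not depend on the read-off radius beyond the range. [cite: LSSY2005, (2.5)] -/
theorem radialProfile_eq_of_readoff (hw : Measurable w) (hM : ∀ r, w r ≤ ENNReal.ofReal M) (hM0 : 0 ≤ M)
    (hρ : 0 ≤ ρ) (hwρ : ∀ s, ρ < s → w s = 0) (hρR : ρ ≤ R) :
    radialProfile w R = radialProfile w ρ := by
  funext r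
  simp only [radialProfile, radialSolDeriv_eq_of_ge hw hM hM0 hρ hwρ hρR]

/-- **The bound on `g_S(x₀) = w_S(x₀)φ_S(x₀)`** at a radius `x₀ ∈ (ρ₁, R]` below which (down to
`ρ₁`) the potential dominates its value at `x₀`: with the shell `v₀ = w_S(x₀)·1_{(ρ₁,x₀]} ≤ w_S`,
`φ_S(x₀) ≤ φ_{v₀}(x₀) = 1 - a(v₀)/x₀` and `squareWell_shell_odeScatteringLength_ge` give
`g_S(x₀) ≤ √(2w_S(x₀))/x₀ + 12x₀/(x₀³ - ρ₁³)`. [cite: FournaisEtAl2024, Prop. 2.1, proof, (3.13)–(3.14)] -/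
theorem pot_mul_radialProfile_le_of_shell (hw : Measurable w) (hM : ∀ r, w r ≤ ENNReal.ofReal M)
    (hM0 : 0 ≤ M) (hR : 0 < R) (hwR : ∀ s, R < s → w s = 0) {ρ₁ x₀ : ℝ} (hρ₁ : 0 < ρ₁) (hx : ρ₁ < x₀)
    (hxR : x₀ ≤ R) (hdom : ∀ r ∈ Ioc ρ₁ x₀, w x₀ ≤ w r) :
    (w x₀).toReal * radialProfile w R x₀ ≤
      Real.sqrt (2 * (w x₀).toReal) / x₀ + 12 * x₀ / (x₀ ^ 3 - ρ₁ ^ 3) := by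
  have hx₀pos : 0 < x₀ := hρ₁.trans hx
  have hx3 : 0 < x₀ ^ 3 - ρ₁ ^ 3 := by
    have := pow_lt_pow_left₀ hx hρ₁.le (by norm_num : (3 : ℕ) ≠ 0)
    linarith
  set K₀ : ℝ := (w x₀).toReal with hK₀
  have hK₀0 : 0 ≤ K₀ := ENNReal.toReal_nonneg
  rcases eq_or_lt_of_le hK₀0 with hK00 | hK₀pos
  · rw [← hK00, zero_mul]; positivity
  -- the shell `v₀ = K₀·1_{(ρ₁, x₀]} ≤ w`
  have hwx₀ : w x₀ = ENNReal.ofReal K₀ := by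
    rw [hK₀, ENNReal.ofReal_toReal (ne_top_of_le_ne_top ENNReal.ofReal_ne_top (hM x₀))]
  set v₀ : ℝ → ℝ≥0∞ := (Ioc ρ₁ x₀).indicator fun _ : ℝ => ENNReal.ofReal K₀ with hv₀
  have hmv₀ : Measurable v₀ := measurable_const.indicator measurableSet_Ioc
  have hKM : K₀ ≤ M := by rw [hK₀]; exact toReal_pot_le hM hM0 x₀
  have hbv₀ : ∀ r, v₀ r ≤ ENNReal.ofReal M := fun r => by
    rw [hv₀]; by_cases h : r ∈ Ioc ρ₁ x₀
    · rw [indicator_of_mem h]; exact ENNReal.ofReal_le_ofReal hKM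
    · rw [indicator_of_notMem h]; exact zero_le
  have hv₀w : ∀ r, v₀ r ≤ w r := fun r => by
    rw [hv₀]; by_cases h : r ∈ Ioc ρ₁ x₀
    · rw [indicator_of_mem h, ← hwx₀]; exact hdom r h
    · rw [indicator_of_notMem h]; exact zero_le
  have hv₀x : ∀ s, x₀ < s → v₀ s = 0 := fun s hs =>
    indicator_of_notMem (show s ∉ Ioc ρ₁ x₀ from fun h => absurd h.2 (not_le.2 hs)) _
  -- `φ(x₀) ≤ φ₀(x₀) = 1 - a₀/x₀`
  have hcomp : radialProfile w R x₀ ≤ radialProfile v₀ R x₀ :=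
    radialProfile_antitone_pot hmv₀ hw hbv₀ hM hM0 hv₀w hR hwR x₀
  rw [radialProfile_eq_of_readoff hmv₀ hbv₀ hM0 hx₀pos.le hv₀x hxR,
    radialProfile_eq_one_sub_div_self hmv₀ hbv₀ hM0 hx₀pos le_rfl hv₀x] at hcomp
  have hshell := squareWell_shell_odeScatteringLength_ge hK₀pos hρ₁ hx
  rw [← hv₀] at hshell
  set a₀ := odeScatteringLength v₀ x₀ with ha₀
  have hsq : K₀ * Real.sqrt (2 / K₀) = Real.sqrt (2 * K₀) := by
    calc K₀ * Real.sqrt (2 / K₀) = K₀ * (Real.sqrt 2 / Real.sqrt K₀) := by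
          rw [Real.sqrt_div (by norm_num : (0 : ℝ) ≤ 2) K₀]
      _ = Real.sqrt 2 * (K₀ / Real.sqrt K₀) := by ring
      _ = Real.sqrt 2 * Real.sqrt K₀ := by rw [Real.div_sqrt]
      _ = Real.sqrt (2 * K₀) := by rw [Real.sqrt_mul (by norm_num : (0 : ℝ) ≤ 2)]
  calc K₀ * radialProfile w R x₀ ≤ K₀ * (1 - a₀ / x₀) := mul_le_mul_of_nonneg_left hcomp hK₀0
    _ = K₀ * (x₀ - a₀) / x₀ := by field_simp
    _ ≤ K₀ * (Real.sqrt (2 / K₀) + 12 * x₀ ^ 2 / (K₀ * (x₀ ^ 3 - ρ₁ ^ 3))) / x₀ := by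
        refine div_le_div_of_nonneg_right (mul_le_mul_of_nonneg_left (by linarith) hK₀0) hx₀pos.le
    _ = Real.sqrt (2 * K₀) / x₀ + 12 * x₀ / (x₀ ^ 3 - ρ₁ ^ 3) := by
        rw [mul_add, hsq]
        field_simp

end PointwiseBound

/-! ### Proposition 2.1 -/

section Prop21

/-- Arithmetic of the core height: `σ = √(2K)/ρ + 12R/(δρ²) ≤ (26C₀² + 24C₀)·λa/ρ³` for
`K = λ²/a²`, `ρ ≤ R ≤ C₀a`, `1/δ ≤ λ/a + 2/ρ`, `λ ≥ 1`. [cite: FournaisEtAl2024, Prop. 2.1, proof, (3.14)] -/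
theorem prop21_sigma_arith {C₀ a lam ρ R δ : ℝ} (ha : 0 < a) (hlam1 : 1 ≤ lam) (hρ : 0 < ρ)
    (hρR : ρ ≤ R) (hRa : R ≤ C₀ * a) (hδ0 : 0 < δ) (hinvδ : 1 / δ ≤ lam / a + 2 / ρ) :
    Real.sqrt (2 * (lam ^ 2 / a ^ 2)) / ρ + 12 * R / (δ * ρ ^ 2) ≤
      (26 * C₀ ^ 2 + 24 * C₀) * (lam * a / ρ ^ 3) := by
  have hlam0 : 0 < lam := by linarith
  have hRpos : 0 < R := hρ.trans_le hρR
  have hρa : ρ ≤ C₀ * a := hρR.trans hRa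
  have hC₀ : 0 < C₀ := by nlinarith
  have hsqK : Real.sqrt (lam ^ 2 / a ^ 2) = lam / a := by
    rw [show lam ^ 2 / a ^ 2 = (lam / a) ^ 2 by ring, Real.sqrt_sq (by positivity)]
  set Mh : ℝ := lam * a / ρ ^ 3 with hMh
  have hMh0 : 0 < Mh := by positivity
  have hρ2 : ρ ^ 2 ≤ C₀ ^ 2 * a ^ 2 := by nlinarith
  have h1 : Real.sqrt (2 * (lam ^ 2 / a ^ 2)) / ρ ≤ 2 * C₀ ^ 2 * Mh := by
    have hs : Real.sqrt (2 * (lam ^ 2 / a ^ 2)) = Real.sqrt 2 * (lam / a) := by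
      rw [Real.sqrt_mul (by norm_num), hsqK]
    have hs2 : Real.sqrt 2 ≤ 2 := by
      rw [show (2 : ℝ) = Real.sqrt 4 by
        rw [show (4 : ℝ) = 2 ^ 2 by norm_num, Real.sqrt_sq (by norm_num)]]
      exact Real.sqrt_le_sqrt (by norm_num)
    rw [hs, hMh, div_le_iff₀ hρ]
    have : Real.sqrt 2 * (lam / a) ≤ 2 * (lam / a) := by gcongr
    refine this.trans ?_
    rw [show 2 * C₀ ^ 2 * (lam * a / ρ ^ 3) * ρ = 2 * (lam / a) * (C₀ ^ 2 * a ^ 2 / ρ ^ 2) by field_simp]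
    have : 1 ≤ C₀ ^ 2 * a ^ 2 / ρ ^ 2 := by rw [le_div_iff₀ (by positivity)]; linarith
    exact le_mul_of_one_le_right (by positivity) this
  have h2 : 12 * R / (δ * ρ ^ 2) ≤ (12 * C₀ ^ 2 + 24 * C₀) * Mh := by
    have hsplit : 12 * R / (δ * ρ ^ 2) = 12 * R / ρ ^ 2 * (1 / δ) := by field_simp
    rw [hsplit]
    calc 12 * R / ρ ^ 2 * (1 / δ) ≤ 12 * R / ρ ^ 2 * (lam / a + 2 / ρ) :=
          mul_le_mul_of_nonneg_left hinvδ (by positivity)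
      _ = 12 * R * lam / (a * ρ ^ 2) + 24 * R / ρ ^ 3 := by field_simp; ring
      _ ≤ 12 * C₀ ^ 2 * Mh + 24 * C₀ * Mh := by
          apply add_le_add
          · rw [hMh, div_le_iff₀ (by positivity)]
            rw [show 12 * C₀ ^ 2 * (lam * a / ρ ^ 3) * (a * ρ ^ 2) = 12 * (C₀ ^ 2 * a ^ 2) * lam / ρ by
              field_simp]
            rw [le_div_iff₀ hρ]
            have hRρ : R * ρ ≤ C₀ * a * (C₀ * a) := mul_le_mul hRa hρa hρ.le (by positivity)
            calc 12 * R * lam * ρ = 12 * lam * (R * ρ) := by ring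
              _ ≤ 12 * lam * (C₀ * a * (C₀ * a)) := mul_le_mul_of_nonneg_left hRρ (by positivity)
              _ = 12 * (C₀ ^ 2 * a ^ 2) * lam := by ring
          · rw [hMh, div_le_iff₀ (by positivity)]
            rw [show 24 * C₀ * (lam * a / ρ ^ 3) * ρ ^ 3 = 24 * (C₀ * a) * lam by field_simp]
            calc 24 * R ≤ 24 * (C₀ * a) := by linarith
              _ = 24 * (C₀ * a) * 1 := by ring
              _ ≤ 24 * (C₀ * a) * lam := mul_le_mul_of_nonneg_left hlam1 (by positivity)
      _ = (12 * C₀ ^ 2 + 24 * C₀) * Mh := by ring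
  calc Real.sqrt (2 * (lam ^ 2 / a ^ 2)) / ρ + 12 * R / (δ * ρ ^ 2)
      ≤ 2 * C₀ ^ 2 * Mh + (12 * C₀ ^ 2 + 24 * C₀) * Mh := add_le_add h1 h2
    _ ≤ (26 * C₀ ^ 2 + 24 * C₀) * Mh := by nlinarith [sq_nonneg C₀]

/-- Arithmetic of the scattering-length loss: `a(1 - C/λ) ≤ ã(1 - 2/λ)` when `ã ≥ a(1 - 2/λ)`,
`λ ≥ C ≥ 4`. [cite: FournaisEtAl2024, Prop. 2.1, proof] -/
theorem prop21_a_arith {a at' lam C : ℝ} (ha : 0 < a) (hC4 : 4 ≤ C) (hlam : C ≤ lam)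
    (hat : a * (1 - 2 / lam) ≤ at') : a * (1 - C / lam) ≤ at' * (1 - 2 / lam) := by
  have hlam0 : 0 < lam := by linarith
  have hx : a * (1 - C / lam) ≤ a * (1 - 4 / lam) := by
    apply mul_le_mul_of_nonneg_left _ ha.le; gcongr
  have hy : a * (1 - 4 / lam) ≤ (a * (1 - 2 / lam)) * (1 - 2 / lam) := by
    have : a * (1 - 4 / lam) = a * ((1 - 2 / lam) * (1 - 2 / lam)) - a * (4 / lam ^ 2) := by ring
    rw [this]; nlinarith [show 0 ≤ a * (4 / lam ^ 2) by positivity]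
  have hz : (a * (1 - 2 / lam)) * (1 - 2 / lam) ≤ at' * (1 - 2 / lam) :=
    mul_le_mul_of_nonneg_right hat (by rw [sub_nonneg, div_le_one hlam0]; linarith)
  linarith

set_option maxHeartbeats 800000 in
/-- **Prop. 2.1 in the case where the core is cut** (`8πλã < ∫ min(V,K)`), with an explicit
admissible constant `C`. [cite: FournaisEtAl2024, Prop. 2.1, proof, (3.10)–(3.14)] -/
theorem FournaisEtAl2024_prop21_of_cut {C₀ C : ℝ} (hC₀ : 0 < C₀) (hC1 : 1 ≤ C) (hC4 : 4 ≤ C)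
    (hC₂ : 26 * C₀ ^ 2 + 24 * C₀ ≤ C) (hCint : 4 * Real.pi * (3 + C₀ ^ 2) ≤ C)
    {V : ℝ → ℝ≥0∞} {R a lam : ℝ} (hV : Measurable V) (hanti : AntitoneOn V (Ioi 0))
    (hVR : ∀ r, R < r → V r = 0) (hR : 0 < R) (ha : 0 < a) (haV : scatteringLength V = ENNReal.ofReal a)
    (hRa : R ≤ C₀ * a) (hlam : C ≤ lam) (W : ℝ → ℝ≥0∞)
    (hW_def : W = fun r => min (V r) (ENNReal.ofReal (lam ^ 2 / a ^ 2)))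
    (hcut' : lam * odeScatteringLength W R < ∫ s in Ioc 0 R, (W s).toReal / 2 * s ^ 2) :
    ∃ v : ℝ → ℝ≥0∞, Measurable v ∧ (∀ r, v r ≤ V r) ∧ (∀ r, v r ≤ ENNReal.ofReal (lam ^ 2 / a ^ 2)) ∧
      (∀ r, R < r → v r = 0) ∧
      a * (1 - C / lam) ≤ (scatteringLength v).toReal ∧ scatteringLength v ≤ scatteringLength V ∧
      (∫⁻ x : Space, v ‖x‖) ≤ ENNReal.ofReal (C * lam * a) ∧
      ∀ x y : ℝ, 0 < x → x ≤ y → (v y).toReal * radialProfile v R y ≤ C * (v x).toReal := by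
  have hlam1 : 1 ≤ lam := hC1.trans hlam
  have hlam4 : 4 ≤ lam := hC4.trans hlam
  have hlam0 : 0 < lam := by linarith
  -- the height cut `W = min(V, K)`
  set K : ℝ := lam ^ 2 / a ^ 2 with hK_def
  have hK : 0 < K := by positivity
  have hmW : Measurable W := hW_def ▸ hV.min measurable_const
  have hbW : ∀ r, W r ≤ ENNReal.ofReal K := fun r => by rw [hW_def]; exact min_le_right _ _
  have hWV : ∀ r, W r ≤ V r := fun r => by rw [hW_def]; exact min_le_left _ _
  have hWR : ∀ s, R < s → W s = 0 := fun s hs => by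
    rw [hW_def]; dsimp only; rw [hVR s hs]; exact min_eq_left zero_le
  have hWanti : AntitoneOn W (Ioi 0) := fun x hx y hy hxy => by
    rw [hW_def]; exact min_le_min (hanti hx hy hxy) le_rfl
  have hWtop : ∀ r, W r ≠ ⊤ := fun r => ne_top_of_le_ne_top ENNReal.ofReal_ne_top (hbW r)
  have hWtoReal : ∀ r, (W r).toReal ≤ K := fun r => toReal_pot_le hbW hK.le r
  set at' : ℝ := odeScatteringLength W R with hat_def
  have hatW : scatteringLength W = ENNReal.ofReal at' :=
    scatteringLength_eq_ofReal_odeScatteringLength hmW hbW hK.le hR hWR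
  have hat0 : 0 ≤ at' := odeScatteringLength_nonneg hmW hbW hK.le hR.le
  have hat_le : at' ≤ a := by
    have h := scatteringLength_mono hWV
    rw [hatW, haV] at h
    exact (ENNReal.ofReal_le_ofReal_iff ha.le).1 h
  have hat_ge' : a * (1 - 2 / lam) ≤ at' := by
    have h := FournaisEtAl2024_lemma33_antitone_toReal hV hanti hVR hK
    rw [← hW_def, haV, hatW, ENNReal.toReal_ofReal ha.le, ENNReal.toReal_ofReal hat0] at h
    have hsqK : Real.sqrt K = lam / a := by
      rw [hK_def, show lam ^ 2 / a ^ 2 = (lam / a) ^ 2 by ring, Real.sqrt_sq (by positivity)]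
    have hs : Real.sqrt (2 / K) = Real.sqrt 2 * a / lam := by
      rw [Real.sqrt_div' _ hK.le, hsqK]; field_simp
    have hs2 : Real.sqrt 2 ≤ 2 := by
      rw [show (2 : ℝ) = Real.sqrt 4 by rw [show (4 : ℝ) = 2 ^ 2 by norm_num, Real.sqrt_sq (by norm_num)]]
      exact Real.sqrt_le_sqrt (by norm_num)
    have : Real.sqrt 2 * a / lam ≤ 2 * a / lam := by gcongr
    have h2 : a * (1 - 2 / lam) = a - 2 * a / lam := by ring
    linarith
  have hat_pos : 0 < at' := by
    have : 0 < a * (1 - 2 / lam) := mul_pos ha (by rw [sub_pos, div_lt_one hlam0]; linarith)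
    linarith
  -- radial integrals
  have hrad : ∀ (u : ℝ → ℝ≥0∞), Measurable u → (∀ s, R < s → u s = 0) →
      (∫⁻ x : Space, u ‖x‖) = ENNReal.ofReal (4 * Real.pi) * ∫⁻ r in Ioc 0 R, ENNReal.ofReal (r ^ 2) * u r := by
    intro u hu huR
    rw [lintegral_comp_norm_eq_sphere hu, lintegral_Ioi_eq_add hR.le]
    congr 1
    rw [setLIntegral_congr_fun measurableSet_Ioi (g := fun _ => 0) fun r hr => by
      rw [huR r hr, mul_zero], lintegral_zero, add_zero]
  have htailW : ∀ {α : ℝ}, 0 ≤ α → ∫⁻ r in Ioc α R, ENNReal.ofReal (r ^ 2) * W r =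
      ENNReal.ofReal (2 * ∫ s in Ioc α R, (W s).toReal / 2 * s ^ 2) := by
    intro α hα
    rw [← integral_const_mul]
    refine lintegral_Ioc_eq_ofReal (C := R ^ 2 * K) (((hmW.ennreal_toReal.div_const 2).mul
      (measurable_id.pow_const 2)).const_mul 2) (fun s hs => ?_) (fun s hs => by positivity)
      (fun s hs => ?_)
    · rw [← ofReal_toReal_pot hbW s, ENNReal.toReal_ofReal ENNReal.toReal_nonneg,
        ← ENNReal.ofReal_mul (sq_nonneg _)]
      congr 1; ring
    · have h1 : s ^ 2 ≤ R ^ 2 := pow_le_pow_left₀ (hα.trans hs.1.le) hs.2 2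
      have h2 := hWtoReal s
      have h0 : 0 ≤ (W s).toReal := ENNReal.toReal_nonneg
      nlinarith
  -- cut out the core (Lemma 3.4 with `S = λ`)
  obtain ⟨ρ, hρ, hρR, hmρ, -, -⟩ := FournaisEtAl2024_lemma34 hmW hbW hK.le hR hWR hat_pos hlam0 hcut'
  have hρa : ρ ≤ C₀ * a := hρR.le.trans hRa
  -- the shell width and the radii
  set ε : ℝ := a / lam with hε
  have hε0 : 0 < ε := by positivity
  set δ : ℝ := min ε (ρ / 2) with hδ
  have hδ0 : 0 < δ := lt_min hε0 (by linarith)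
  have hδε : δ ≤ ε := min_le_left _ _
  set ρ₁ : ℝ := ρ - δ with hρ₁
  have hρ₁0 : 0 < ρ₁ := by rw [hρ₁]; linarith [min_le_right ε (ρ / 2)]
  have hρ₁ρ : ρ₁ < ρ := by rw [hρ₁]; linarith
  have hcube : δ * ρ ^ 2 ≤ ρ ^ 3 - ρ₁ ^ 3 := by
    have e : ρ ^ 3 - ρ₁ ^ 3 = δ * (ρ ^ 2 + ρ * ρ₁ + ρ₁ ^ 2) := by rw [hρ₁]; ring
    rw [e]
    refine mul_le_mul_of_nonneg_left ?_ hδ0.le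
    have h1 : 0 ≤ ρ * ρ₁ := mul_nonneg hρ.le hρ₁0.le
    have h2 : 0 ≤ ρ₁ ^ 2 := sq_nonneg _
    linarith only [h1, h2]
  have hρ2 : ρ ^ 2 ≤ C₀ ^ 2 * a ^ 2 := by
    calc ρ ^ 2 = ρ * ρ := sq ρ
      _ ≤ (C₀ * a) * (C₀ * a) := mul_le_mul hρa hρa hρ.le (by positivity)
      _ = C₀ ^ 2 * a ^ 2 := by ring
  have hinvδ : 1 / δ ≤ lam / a + 2 / ρ := by
    have h1 : 1 / ε = lam / a := by rw [hε]; field_simp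
    rw [hδ, ← h1]
    rcases le_total ε (ρ / 2) with h | h
    · rw [min_eq_left h]; have : 0 ≤ 2 / ρ := by positivity
      linarith
    · rw [min_eq_right h]
      have : 0 ≤ 1 / ε := by positivity
      rw [show (1 : ℝ) / (ρ / 2) = 2 / ρ by field_simp]
      linarith
  -- the refilled potential `w_S`
  obtain ⟨wS, hwS_def⟩ : ∃ wS : ℝ → ℝ≥0∞,
      wS = fun r => if r ∈ Ioc ρ₁ ρ then W ρ else if r ∈ Ioi ρ then W r else 0 := ⟨_, rfl⟩
  have hmwS : Measurable wS :=
    hwS_def ▸ Measurable.ite measurableSet_Ioc measurable_const (Measurable.ite measurableSet_Ioi hmW measurable_const)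
  have hwS_shell : ∀ r, ρ₁ < r → r ≤ ρ → wS r = W ρ := fun r h1 h2 => by
    rw [hwS_def]; dsimp only; rw [if_pos ⟨h1, h2⟩]
  have hwS_tail : ∀ r, ρ < r → wS r = W r := fun r h => by
    rw [hwS_def]; dsimp only
    rw [if_neg (fun h' => absurd h'.2 (not_le.2 h)), if_pos (mem_Ioi.2 h)]
  have hwS_core : ∀ r, r ≤ ρ₁ → wS r = 0 := fun r h => by
    rw [hwS_def]; dsimp only
    rw [if_neg (fun h' => absurd h'.1 (not_lt.2 h)),
      if_neg (fun h' => absurd (mem_Ioi.1 h') (not_lt.2 (h.trans hρ₁ρ.le)))]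
  have hwS_le_Wρ : ∀ r, ρ₁ < r → wS r ≤ W ρ := fun r hr => by
    rcases le_or_gt r ρ with h | h
    · rw [hwS_shell r hr h]
    · rw [hwS_tail r h]; exact hWanti hρ (hρ.trans h) h.le
  have hbwS : ∀ r, wS r ≤ ENNReal.ofReal K := fun r => by
    rcases le_or_gt r ρ₁ with h | h
    · rw [hwS_core r h]; exact zero_le
    · exact (hwS_le_Wρ r h).trans (hbW ρ)
  have hwSR : ∀ s, R < s → wS s = 0 := fun s hs => by rw [hwS_tail s (hρR.trans hs)]; exact hWR s hs
  have hwS_anti : ∀ x y, ρ₁ < x → x ≤ y → wS y ≤ wS x := by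
    intro x y hx hxy
    rcases le_or_gt x ρ with h | h
    · rw [hwS_shell x hx h]; exact hwS_le_Wρ y (hx.trans_le hxy)
    · rw [hwS_tail x h, hwS_tail y (h.trans_le hxy)]
      exact hWanti (hρ.trans h) (hρ.trans (h.trans_le hxy)) hxy
  have hwS_le_W : ∀ r, 0 < r → wS r ≤ W r := fun r hr => by
    rcases le_or_gt r ρ₁ with h | h
    · rw [hwS_core r h]; exact zero_le
    rcases le_or_gt r ρ with h' | h'
    · rw [hwS_shell r h h']; exact hWanti hr hρ h'
    · rw [hwS_tail r h']
  have hwStop : ∀ r, wS r ≠ ⊤ := fun r => ne_top_of_le_ne_top ENNReal.ofReal_ne_top (hbwS r)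
  -- the bound `σ` on `g_S = w_S φ_S`
  set σ : ℝ := Real.sqrt (2 * K) / ρ + 12 * R / (δ * ρ ^ 2) with hσ
  have hσ0 : 0 ≤ σ := by positivity
  set Mh : ℝ := lam * a / ρ ^ 3 with hMh
  have hMh0 : 0 < Mh := by positivity
  have hgS : ∀ r, ρ₁ < r → (wS r).toReal * radialProfile wS R r ≤ σ := by
    have hmain : ∀ r, ρ ≤ r → r ≤ R → (wS r).toReal * radialProfile wS R r ≤ σ := by
      intro r hr hrR
      have hr0 : 0 < r := hρ.trans_le hr
      have h := pot_mul_radialProfile_le_of_shell hmwS hbwS hK.le hR hwSR hρ₁0 (hρ₁ρ.trans_le hr) hrR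
        (fun s hs => hwS_anti s r hs.1 hs.2)
      refine h.trans (add_le_add ?_ ?_)
      · have h1 : Real.sqrt (2 * (wS r).toReal) ≤ Real.sqrt (2 * K) :=
          Real.sqrt_le_sqrt (by linarith [toReal_pot_le hbwS hK.le r])
        calc Real.sqrt (2 * (wS r).toReal) / r ≤ Real.sqrt (2 * K) / r :=
              div_le_div_of_nonneg_right h1 hr0.le
          _ ≤ Real.sqrt (2 * K) / ρ := div_le_div_of_nonneg_left (Real.sqrt_nonneg _) hρ hr
      · have h3 : δ * ρ ^ 2 ≤ r ^ 3 - ρ₁ ^ 3 := by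
          have := pow_le_pow_left₀ hρ.le hr 3
          linarith only [this, hcube]
        have h3' : 0 < r ^ 3 - ρ₁ ^ 3 := lt_of_lt_of_le (by positivity) h3
        calc 12 * r / (r ^ 3 - ρ₁ ^ 3) ≤ 12 * R / (r ^ 3 - ρ₁ ^ 3) :=
              div_le_div_of_nonneg_right (by linarith) h3'.le
          _ ≤ 12 * R / (δ * ρ ^ 2) := div_le_div_of_nonneg_left (by positivity) (by positivity) h3
    intro r hr
    rcases le_or_gt ρ r with h | h
    · rcases le_or_gt r R with h' | h'
      · exact hmain r h h'
      · rw [hwSR r h', ENNReal.toReal_zero, zero_mul]; exact hσ0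
    · have hmono := monotoneOn_radialProfile hmwS hbwS hK.le R
      have hφ : radialProfile wS R r ≤ radialProfile wS R ρ :=
        hmono (mem_Ici.2 (hρ₁0.trans hr).le) (mem_Ici.2 hρ.le) h.le
      calc (wS r).toReal * radialProfile wS R r = (W ρ).toReal * radialProfile wS R r := by
            rw [hwS_shell r hr h.le]
        _ ≤ (W ρ).toReal * radialProfile wS R ρ := mul_le_mul_of_nonneg_left hφ ENNReal.toReal_nonneg
        _ = (wS ρ).toReal * radialProfile wS R ρ := by rw [hwS_shell ρ hρ₁ρ le_rfl]
        _ ≤ σ := hmain ρ le_rfl hρR.le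
  have hσM : σ ≤ C * Mh :=
    (prop21_sigma_arith ha hlam1 hρ hρR.le hRa hδ0 hinvδ).trans (mul_le_mul_of_nonneg_right hC₂ hMh0.le)
  -- the core height `m₀ = min(σ, M, W(ρ))` and the potential `v`
  set m₀ : ℝ := min (min σ Mh) (W ρ).toReal with hm₀
  have hm₀0 : 0 ≤ m₀ := le_min (le_min hσ0 hMh0.le) ENNReal.toReal_nonneg
  have hm₀M : m₀ ≤ Mh := (min_le_left _ _).trans (min_le_right _ _)
  have hm₀W : ENNReal.ofReal m₀ ≤ W ρ :=
    (ENNReal.ofReal_le_ofReal (min_le_right _ _)).trans ENNReal.ofReal_toReal_le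
  have hm₀K : m₀ ≤ K := (min_le_right _ _).trans (hWtoReal ρ)
  obtain ⟨v, hv_def⟩ : ∃ v : ℝ → ℝ≥0∞, v = fun r => if r ∈ Ioc 0 ρ₁ then ENNReal.ofReal m₀ else wS r :=
    ⟨_, rfl⟩
  have hmv : Measurable v := hv_def ▸ Measurable.ite measurableSet_Ioc measurable_const hmwS
  have hv_core : ∀ r, 0 < r → r ≤ ρ₁ → v r = ENNReal.ofReal m₀ := fun r h1 h2 => by
    rw [hv_def]; dsimp only; rw [if_pos ⟨h1, h2⟩]
  have hv_out : ∀ r, ρ₁ < r → v r = wS r := fun r h => by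
    rw [hv_def]; dsimp only; rw [if_neg (fun h' => absurd h'.2 (not_le.2 h))]
  have hv_nonpos : ∀ r, r ≤ 0 → v r = 0 := fun r h => by
    rw [hv_def]; dsimp only
    rw [if_neg (fun h' => absurd h'.1 (not_lt.2 h)), hwS_core r (h.trans hρ₁0.le)]
  have hvV : ∀ r, v r ≤ V r := by
    intro r
    rcases le_or_gt r 0 with h0 | h0
    · rw [hv_nonpos r h0]; exact zero_le
    rcases le_or_gt r ρ₁ with h1 | h1
    · rw [hv_core r h0 h1]
      exact hm₀W.trans ((hWanti h0 hρ (h1.trans hρ₁ρ.le)).trans (hWV r))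
    · rw [hv_out r h1]; exact (hwS_le_W r h0).trans (hWV r)
  have hbv : ∀ r, v r ≤ ENNReal.ofReal K := by
    intro r
    rcases le_or_gt r 0 with h0 | h0
    · rw [hv_nonpos r h0]; exact zero_le
    rcases le_or_gt r ρ₁ with h1 | h1
    · rw [hv_core r h0 h1]; exact ENNReal.ofReal_le_ofReal hm₀K
    · rw [hv_out r h1]; exact hbwS r
  have hvR : ∀ s, R < s → v s = 0 := fun s hs => by
    rw [hv_out s (hρ₁ρ.trans (hρR.trans hs))]; exact hwSR s hs
  have hwSv : ∀ r, wS r ≤ v r := by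
    intro r
    rcases le_or_gt r ρ₁ with h1 | h1
    · rw [hwS_core r h1]; exact zero_le
    · rw [hv_out r h1]
  -- the scattering length of `v`
  have hWSv : ∀ r, (Ioi ρ).indicator W r ≤ v r := by
    intro r
    by_cases h : r ∈ Ioi ρ
    · rw [indicator_of_mem h, hv_out r (hρ₁ρ.trans h), hwS_tail r h]
    · rw [indicator_of_notMem h]; exact zero_le
  have hmWS : Measurable ((Ioi ρ).indicator W) := hmW.indicator measurableSet_Ioi
  have hbWS : ∀ r, (Ioi ρ).indicator W r ≤ ENNReal.ofReal K := fun r =>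
    (indicator_le_self _ _ r).trans (hbW r)
  have hWSR : ∀ s, R < s → (Ioi ρ).indicator W s = 0 := fun s hs => by
    by_cases h : s ∈ Ioi ρ
    · rw [indicator_of_mem h]; exact hWR s hs
    · exact indicator_of_notMem h _
  have hlow34 : at' * (1 - 2 / lam) ≤ odeScatteringLength ((Ioi ρ).indicator W) R := by
    obtain ⟨ρ', _, _, hm', hlow', -⟩ := FournaisEtAl2024_lemma34 hmW hbW hK.le hR hWR hat_pos hlam0 hcut'
    -- the radius of Lemma 3.4 is the one we use (we re-obtain it to keep the statement); but
    -- `ρ` above came from the same existential, so we use `hlow'` for `ρ'`... to avoid this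
    -- mismatch we prove the bound directly from the radius form:
    have hm0 : 0 < ∫ s in Ioc ρ R, (W s).toReal / 2 * s ^ 2 := by rw [hmρ]; positivity
    have h := FournaisEtAl2024_lemma34_radius hmW hbW hK.le hR hWR hat_pos hρ hρR hm0
    rw [hmρ] at h
    have : at' - 2 * at' ^ 2 / (lam * at') = at' * (1 - 2 / lam) := by field_simp
    rw [this] at h
    exact h
  have hav : scatteringLength v = ENNReal.ofReal (odeScatteringLength v R) :=
    scatteringLength_eq_ofReal_odeScatteringLength hmv hbv hK.le hR hvR
  have hav_ge : a * (1 - C / lam) ≤ (scatteringLength v).toReal := by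
    have h1 : scatteringLength ((Ioi ρ).indicator W) ≤ scatteringLength v := scatteringLength_mono hWSv
    rw [scatteringLength_eq_ofReal_odeScatteringLength hmWS hbWS hK.le hR hWSR, hav] at h1
    rw [hav, ENNReal.toReal_ofReal (odeScatteringLength_nonneg hmv hbv hK.le hR.le)]
    have h2 := (ENNReal.ofReal_le_ofReal_iff (odeScatteringLength_nonneg hmv hbv hK.le hR.le)).1 h1
    have h3 := prop21_a_arith ha hC4 hlam hat_ge'
    linarith
  -- the integral of `v`
  have hint : (∫⁻ x : Space, v ‖x‖) ≤ ENNReal.ofReal (C * lam * a) := by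
    rw [hrad v hmv hvR, lintegral_Ioc_eq_add hρ₁0.le (hρ₁ρ.le.trans hρR.le),
      lintegral_Ioc_eq_add hρ₁ρ.le hρR.le]
    have hI1 : ∫⁻ r in Ioc 0 ρ₁, ENNReal.ofReal (r ^ 2) * v r ≤ ENNReal.ofReal (lam * a) := by
      calc ∫⁻ r in Ioc 0 ρ₁, ENNReal.ofReal (r ^ 2) * v r
          ≤ ∫⁻ _ in Ioc 0 ρ₁, ENNReal.ofReal (ρ₁ ^ 2) * ENNReal.ofReal Mh := by
            refine setLIntegral_mono' measurableSet_Ioc fun r hr => ?_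
            rw [hv_core r hr.1 hr.2]
            exact mul_le_mul' (ENNReal.ofReal_le_ofReal (pow_le_pow_left₀ hr.1.le hr.2 2))
              (ENNReal.ofReal_le_ofReal hm₀M)
        _ = ENNReal.ofReal (ρ₁ ^ 2 * Mh * ρ₁) := by
            rw [setLIntegral_const, Real.volume_Ioc, sub_zero, ← ENNReal.ofReal_mul (sq_nonneg _),
              ← ENNReal.ofReal_mul (by positivity)]
        _ ≤ ENNReal.ofReal (lam * a) := by
            refine ENNReal.ofReal_le_ofReal ?_
            have h1 : ρ₁ ^ 2 * Mh * ρ₁ = lam * a * (ρ₁ ^ 3 / ρ ^ 3) := by rw [hMh]; field_simp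
            rw [h1]
            have h2 : ρ₁ ^ 3 / ρ ^ 3 ≤ 1 := by
              rw [div_le_one (by positivity)]; exact pow_le_pow_left₀ hρ₁0.le hρ₁ρ.le 3
            exact mul_le_of_le_one_right (by positivity) h2
    have hI2 : ∫⁻ r in Ioc ρ₁ ρ, ENNReal.ofReal (r ^ 2) * v r ≤ ENNReal.ofReal (C₀ ^ 2 * lam * a) := by
      calc ∫⁻ r in Ioc ρ₁ ρ, ENNReal.ofReal (r ^ 2) * v r
          ≤ ∫⁻ _ in Ioc ρ₁ ρ, ENNReal.ofReal (ρ ^ 2) * ENNReal.ofReal K := by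
            refine setLIntegral_mono' measurableSet_Ioc fun r hr => ?_
            exact mul_le_mul' (ENNReal.ofReal_le_ofReal (pow_le_pow_left₀ (hρ₁0.trans hr.1).le hr.2 2))
              (hbv r)
        _ = ENNReal.ofReal (ρ ^ 2 * K * δ) := by
            rw [setLIntegral_const, Real.volume_Ioc, show ρ - ρ₁ = δ by rw [hρ₁]; ring,
              ← ENNReal.ofReal_mul (sq_nonneg _), ← ENNReal.ofReal_mul (by positivity)]
        _ ≤ ENNReal.ofReal (C₀ ^ 2 * lam * a) := by
            refine ENNReal.ofReal_le_ofReal ?_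
            calc ρ ^ 2 * K * δ ≤ C₀ ^ 2 * a ^ 2 * K * ε := by
                  have := hK.le; gcongr
              _ = C₀ ^ 2 * lam * a := by rw [hK_def, hε]; field_simp
    have hI3 : ∫⁻ r in Ioc ρ R, ENNReal.ofReal (r ^ 2) * v r ≤ ENNReal.ofReal (2 * lam * a) := by
      calc ∫⁻ r in Ioc ρ R, ENNReal.ofReal (r ^ 2) * v r = ∫⁻ r in Ioc ρ R, ENNReal.ofReal (r ^ 2) * W r :=
            setLIntegral_congr_fun measurableSet_Ioc fun r hr => by rw [hv_out r (hρ₁ρ.trans hr.1), hwS_tail r hr.1]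
        _ = ENNReal.ofReal (2 * (lam * at')) := by rw [htailW hρ.le, hmρ]
        _ ≤ ENNReal.ofReal (2 * lam * a) := ENNReal.ofReal_le_ofReal (by
            have := mul_le_mul_of_nonneg_left hat_le hlam0.le; linarith only [this])
    calc ENNReal.ofReal (4 * Real.pi) * ((∫⁻ r in Ioc 0 ρ₁, ENNReal.ofReal (r ^ 2) * v r) +
          ((∫⁻ r in Ioc ρ₁ ρ, ENNReal.ofReal (r ^ 2) * v r) + ∫⁻ r in Ioc ρ R, ENNReal.ofReal (r ^ 2) * v r))
        ≤ ENNReal.ofReal (4 * Real.pi) * (ENNReal.ofReal (lam * a) +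
            (ENNReal.ofReal (C₀ ^ 2 * lam * a) + ENNReal.ofReal (2 * lam * a))) := by
          gcongr
      _ = ENNReal.ofReal (4 * Real.pi * ((lam * a) + (C₀ ^ 2 * lam * a + 2 * lam * a))) := by
          rw [← ENNReal.ofReal_add (by positivity) (by positivity), ← ENNReal.ofReal_add (by positivity) (by positivity),
            ← ENNReal.ofReal_mul (by positivity)]
      _ ≤ ENNReal.ofReal (C * lam * a) := by
          refine ENNReal.ofReal_le_ofReal ?_
          calc 4 * Real.pi * (lam * a + (C₀ ^ 2 * lam * a + 2 * lam * a))
              = 4 * Real.pi * (3 + C₀ ^ 2) * (lam * a) := by ring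
            _ ≤ C * (lam * a) := mul_le_mul_of_nonneg_right hCint (by positivity)
            _ = C * lam * a := by ring
  -- (2.5)
  have h25 : ∀ x y : ℝ, 0 < x → x ≤ y → (v y).toReal * radialProfile v R y ≤ C * (v x).toReal := by
    intro x y hx hxy
    have hy : 0 < y := hx.trans_le hxy
    have hφ1 : ∀ r, radialProfile v R r ≤ 1 := radialProfile_le_one hmv hbv hK.le hR hvR
    have hφ0 : ∀ r, 0 ≤ radialProfile v R r := fun r => (radialProfile_pos hmv hbv hK.le R r).le
    rcases lt_or_ge ρ₁ x with hx1 | hx1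
    · calc (v y).toReal * radialProfile v R y ≤ (v y).toReal * 1 :=
            mul_le_mul_of_nonneg_left (hφ1 y) ENNReal.toReal_nonneg
        _ ≤ (v x).toReal := by
            rw [mul_one, hv_out x hx1, hv_out y (hx1.trans_le hxy)]
            exact ENNReal.toReal_mono (hwStop x) (hwS_anti x y hx1 hxy)
        _ ≤ C * (v x).toReal := le_mul_of_one_le_left ENNReal.toReal_nonneg hC1
    · have hvx : (v x).toReal = m₀ := by rw [hv_core x hx hx1, ENNReal.toReal_ofReal hm₀0]
      have hcompφ : ∀ r, radialProfile v R r ≤ radialProfile wS R r := fun r =>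
        radialProfile_antitone_pot hmwS hmv hbwS hbv hK.le hwSv hR hvR r
      have hgv : (v y).toReal * radialProfile v R y ≤ min σ (W ρ).toReal := by
        rcases le_or_gt y ρ with hyρ | hyρ
        · have hvy : v y ≤ W ρ := by
            rcases le_or_gt y ρ₁ with h | h
            · rw [hv_core y hy h]; exact hm₀W
            · rw [hv_out y h, hwS_shell y h hyρ]
          have hmono := monotoneOn_radialProfile hmv hbv hK.le R
          have hφy : radialProfile v R y ≤ radialProfile v R ρ :=
            hmono (mem_Ici.2 hy.le) (mem_Ici.2 hρ.le) hyρ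
          have hg : (v y).toReal * radialProfile v R y ≤ (W ρ).toReal * radialProfile wS R ρ :=
            calc (v y).toReal * radialProfile v R y ≤ (W ρ).toReal * radialProfile v R ρ :=
                  mul_le_mul (ENNReal.toReal_mono (hWtop ρ) hvy) hφy (hφ0 y) ENNReal.toReal_nonneg
              _ ≤ (W ρ).toReal * radialProfile wS R ρ :=
                  mul_le_mul_of_nonneg_left (hcompφ ρ) ENNReal.toReal_nonneg
          refine le_min (hg.trans ?_) (hg.trans ?_)
          · rw [← hwS_shell ρ hρ₁ρ le_rfl]; exact hgS ρ hρ₁ρ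
          · exact mul_le_of_le_one_right ENNReal.toReal_nonneg
              (radialProfile_le_one hmwS hbwS hK.le hR hwSR ρ)
        · have hyo : ρ₁ < y := hρ₁ρ.trans hyρ
          have hg : (v y).toReal * radialProfile v R y ≤ (wS y).toReal * radialProfile wS R y := by
            rw [hv_out y hyo]
            exact mul_le_mul_of_nonneg_left (hcompφ y) ENNReal.toReal_nonneg
          refine le_min (hg.trans (hgS y hyo)) (hg.trans ?_)
          calc (wS y).toReal * radialProfile wS R y ≤ (wS y).toReal * 1 :=
                mul_le_mul_of_nonneg_left (radialProfile_le_one hmwS hbwS hK.le hR hwSR y) ENNReal.toReal_nonneg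
            _ ≤ (W ρ).toReal := by rw [mul_one]; exact ENNReal.toReal_mono (hWtop ρ) (hwS_le_Wρ y hyo)
      rw [hvx]
      rcases le_or_gt (min σ (W ρ).toReal) Mh with hcase' | hcase'
      · have hm : m₀ = min σ (W ρ).toReal := by
          rw [hm₀, min_right_comm, min_eq_left hcase']
        rw [hm]
        exact hgv.trans (le_mul_of_one_le_left (le_min hσ0 ENNReal.toReal_nonneg) hC1)
      · have hm : m₀ = Mh := by
          rw [hm₀, min_right_comm, min_eq_right hcase'.le]
        rw [hm]
        exact hgv.trans ((min_le_left _ _).trans hσM)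
  exact ⟨v, hmv, hvV, hbv, hvR, hav_ge, scatteringLength_mono hvV, hint, h25⟩

/-- **FGJMOT Prop. 2.1 (replacement by an integrable potential), dimensionless form.** For every
`C₀ > 0` there is `C > 0` such that: if `V` is a measurable radial profile, non-increasing on
`(0, ∞)` (hard core allowed), vanishing beyond `R ≤ C₀a` where `0 < a = a(V) < ∞` is its scattering
length, then for every `λ ≥ C` (in the paper `λ = ℓ/a = K_ℓ(ρa³)^{-1/2}`, large in the dilute
limit) there is a measurable profile `0 ≤ v ≤ V`, vanishing beyond `R`, with
`v ≤ λ²/a²` (`= ℓ²a⁻⁴`), `a(1 - C/λ) ≤ a(v) ≤ a` (`0 ≤ a - a(v) ≤ Ca²/ℓ = Ca√(ρa³)K_ℓ⁻¹`),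
`∫_{ℝ³} v(|x|)dx ≤ Cλa` (`= C(ρa)^{-1/2}K_ℓ`), and the monotonicity substitute (2.5):
`g_v(y) = v(y)φ_v(y) ≤ C v(x)` for `0 < x ≤ y`, `φ_v` the scattering solution of `v`
(`radialProfile v R`). Construction of the paper: cut `V` at height `K = λ²/a²` (Lemma 3.3); if
`∫ min(V,K) ≤ 8πλ a(min(V,K))` take `v = min(V,K)`; otherwise cut out the core inside `R_S`,
`∫_{|x|>R_S} = 8πλ ã` (Lemma 3.4), refill the shell `(R_S - ε, R_S]` (`ε = min(a/λ, R_S/2)`) at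
height `V(R_S)` and the core at height `min(σ, M, V(R_S))`, `M = λa/R_S³`, where
`σ = √(2K)/R_S + 12R/(εR_S²) ≥ sup g_S` by `pot_mul_radialProfile_le_of_shell` (the paper takes
`σ = max g_S`; no maximiser is needed). [cite: FournaisEtAl2024, Prop. 2.1, (2.4)–(2.5), and its proof §3 (3.10)–(3.14)] -/
theorem FournaisEtAl2024_prop21 (C₀ : ℝ) (hC₀ : 0 < C₀) :
    ∃ C : ℝ, 0 < C ∧ ∀ (V : ℝ → ℝ≥0∞) (R a lam : ℝ), Measurable V → AntitoneOn V (Ioi 0) →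
      (∀ r, R < r → V r = 0) → 0 < a → scatteringLength V = ENNReal.ofReal a → R ≤ C₀ * a → C ≤ lam →
      ∃ v : ℝ → ℝ≥0∞, Measurable v ∧ (∀ r, v r ≤ V r) ∧ (∀ r, v r ≤ ENNReal.ofReal (lam ^ 2 / a ^ 2)) ∧
        (∀ r, R < r → v r = 0) ∧
        a * (1 - C / lam) ≤ (scatteringLength v).toReal ∧ scatteringLength v ≤ scatteringLength V ∧
        (∫⁻ x : Space, v ‖x‖) ≤ ENNReal.ofReal (C * lam * a) ∧
        ∀ x y : ℝ, 0 < x → x ≤ y → (v y).toReal * radialProfile v R y ≤ C * (v x).toReal := by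
  set C : ℝ := 50 + 26 * C₀ ^ 2 + 24 * C₀ + 4 * Real.pi * C₀ ^ 2 with hC_def
  have hpi := Real.pi_le_four
  have hpi0 := Real.pi_pos
  have hCpos : 0 < C := by rw [hC_def]; positivity
  have hC4 : 4 ≤ C := by rw [hC_def]; nlinarith [sq_nonneg C₀]
  have hC1 : 1 ≤ C := by linarith
  have hC₂ : 26 * C₀ ^ 2 + 24 * C₀ ≤ C := by rw [hC_def]; nlinarith [sq_nonneg C₀]
  have hCint : 4 * Real.pi * (3 + C₀ ^ 2) ≤ C := by
    rw [hC_def]; nlinarith [mul_le_mul_of_nonneg_right hpi (sq_nonneg C₀)]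
  have hC8 : 8 * Real.pi ≤ C := by rw [hC_def]; nlinarith [sq_nonneg C₀]
  refine ⟨C, hCpos, ?_⟩
  intro V R a lam hV hanti hVR ha haV hRa hlam
  have hlam0 : 0 < lam := by linarith
  -- `R > 0`
  have hR : 0 < R := by
    by_contra h
    push Not at h
    have h0 : scatteringLength V = scatteringLength (fun _ => (0 : ℝ≥0∞)) :=
      scatteringLength_congr_Ioi fun r hr => hVR r (h.trans_lt hr)
    have : scatteringLength (fun _ : ℝ => (0 : ℝ≥0∞)) = 0 := scatteringLength_zero
    rw [h0, this] at haV
    exact absurd haV.symm (ENNReal.ofReal_pos.2 ha).ne'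
  set K : ℝ := lam ^ 2 / a ^ 2 with hK_def
  have hK : 0 < K := by positivity
  obtain ⟨W, hW_def⟩ : ∃ W : ℝ → ℝ≥0∞, W = fun r => min (V r) (ENNReal.ofReal K) := ⟨_, rfl⟩
  have hmW : Measurable W := hW_def ▸ hV.min measurable_const
  have hbW : ∀ r, W r ≤ ENNReal.ofReal K := fun r => by rw [hW_def]; exact min_le_right _ _
  have hWV : ∀ r, W r ≤ V r := fun r => by rw [hW_def]; exact min_le_left _ _
  have hWR : ∀ s, R < s → W s = 0 := fun s hs => by
    rw [hW_def]; dsimp only; rw [hVR s hs]; exact min_eq_left zero_le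
  have hWanti : AntitoneOn W (Ioi 0) := fun x hx y hy hxy => by
    rw [hW_def]; exact min_le_min (hanti hx hy hxy) le_rfl
  have hWtop : ∀ r, W r ≠ ⊤ := fun r => ne_top_of_le_ne_top ENNReal.ofReal_ne_top (hbW r)
  have hWtoReal : ∀ r, (W r).toReal ≤ K := fun r => toReal_pot_le hbW hK.le r
  set at' : ℝ := odeScatteringLength W R with hat_def
  have hatW : scatteringLength W = ENNReal.ofReal at' :=
    scatteringLength_eq_ofReal_odeScatteringLength hmW hbW hK.le hR hWR
  have hat0 : 0 ≤ at' := odeScatteringLength_nonneg hmW hbW hK.le hR.le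
  have hat_le : at' ≤ a := by
    have h := scatteringLength_mono hWV
    rw [hatW, haV] at h
    exact (ENNReal.ofReal_le_ofReal_iff ha.le).1 h
  have hat_ge' : a * (1 - 2 / lam) ≤ at' := by
    have h := FournaisEtAl2024_lemma33_antitone_toReal hV hanti hVR hK
    rw [← hW_def, haV, hatW, ENNReal.toReal_ofReal ha.le, ENNReal.toReal_ofReal hat0] at h
    have hsqK : Real.sqrt K = lam / a := by
      rw [hK_def, show lam ^ 2 / a ^ 2 = (lam / a) ^ 2 by ring, Real.sqrt_sq (by positivity)]
    have hs : Real.sqrt (2 / K) = Real.sqrt 2 * a / lam := by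
      rw [Real.sqrt_div' _ hK.le, hsqK]; field_simp
    have hs2 : Real.sqrt 2 ≤ 2 := by
      rw [show (2 : ℝ) = Real.sqrt 4 by rw [show (4 : ℝ) = 2 ^ 2 by norm_num, Real.sqrt_sq (by norm_num)]]
      exact Real.sqrt_le_sqrt (by norm_num)
    have : Real.sqrt 2 * a / lam ≤ 2 * a / lam := by gcongr
    have h2 : a * (1 - 2 / lam) = a - 2 * a / lam := by ring
    linarith
  by_cases hcase : (∫ s in Ioc 0 R, (W s).toReal / 2 * s ^ 2) ≤ lam * at'
  · -- CASE I: nothing to cut, `v = min(V, K)`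
    refine ⟨W, hmW, hWV, hbW, hWR, ?_, scatteringLength_mono hWV, ?_, ?_⟩
    · rw [hatW, ENNReal.toReal_ofReal hat0]
      have h3 := prop21_a_arith ha hC4 hlam hat_ge'
      have : at' * (1 - 2 / lam) ≤ at' := by
        apply mul_le_of_le_one_right hat0
        have : 0 ≤ 2 / lam := by positivity
        linarith
      linarith
    · rw [lintegral_comp_norm_eq_sphere hmW, lintegral_Ioi_eq_add hR.le,
        setLIntegral_congr_fun measurableSet_Ioi (s := Ioi R) (g := fun _ => 0) fun r hr => by
          rw [hWR r hr, mul_zero], lintegral_zero, add_zero]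
      have htail : ∫⁻ r in Ioc 0 R, ENNReal.ofReal (r ^ 2) * W r =
          ENNReal.ofReal (2 * ∫ s in Ioc 0 R, (W s).toReal / 2 * s ^ 2) := by
        rw [← integral_const_mul]
        refine lintegral_Ioc_eq_ofReal (C := R ^ 2 * K) (((hmW.ennreal_toReal.div_const 2).mul
          (measurable_id.pow_const 2)).const_mul 2) (fun s hs => ?_) (fun s hs => by positivity)
          (fun s hs => ?_)
        · rw [← ofReal_toReal_pot hbW s, ENNReal.toReal_ofReal ENNReal.toReal_nonneg,
            ← ENNReal.ofReal_mul (sq_nonneg _)]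
          congr 1; ring
        · have h1 : s ^ 2 ≤ R ^ 2 := pow_le_pow_left₀ hs.1.le hs.2 2
          have h2 := hWtoReal s
          have h0 : 0 ≤ (W s).toReal := ENNReal.toReal_nonneg
          nlinarith
      rw [htail, ← ENNReal.ofReal_mul (by positivity)]
      refine ENNReal.ofReal_le_ofReal ?_
      calc 4 * Real.pi * (2 * ∫ s in Ioc 0 R, (W s).toReal / 2 * s ^ 2)
          ≤ 4 * Real.pi * (2 * (lam * at')) := by gcongr
        _ = 8 * Real.pi * (lam * at') := by ring
        _ ≤ C * (lam * a) := mul_le_mul hC8 (mul_le_mul_of_nonneg_left hat_le hlam0.le) (by positivity) hCpos.le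
        _ = C * lam * a := by ring
    · intro x y hx hxy
      have hy : 0 < y := hx.trans_le hxy
      have hφ1 : radialProfile W R y ≤ 1 := radialProfile_le_one hmW hbW hK.le hR hWR y
      calc (W y).toReal * radialProfile W R y ≤ (W y).toReal * 1 :=
            mul_le_mul_of_nonneg_left hφ1 ENNReal.toReal_nonneg
        _ ≤ (W x).toReal := by rw [mul_one]; exact ENNReal.toReal_mono (hWtop x) (hWanti hx hy hxy)
        _ ≤ C * (W x).toReal := le_mul_of_one_le_left ENNReal.toReal_nonneg hC1
  · -- CASE II
    push Not at hcase
    exact FournaisEtAl2024_prop21_of_cut hC₀ hC1 hC4 hC₂ hCint hV hanti hVR hR ha haV hRa hlam W hW_def hcase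

/-- **FGJMOT Prop. 2.1 in the parametrisation of the paper**: with `ℓ = K_ℓ(ρa)^{-1/2}`
(so `ℓ/a = K_ℓ(ρa³)^{-1/2}`), for `K_ℓ(ρa³)^{-1/2} ≥ C` (large in the dilute limit, `K_ℓ = (ρa³)^{-η}`):
`0 ≤ a - a(v) ≤ Ca√(ρa³)K_ℓ⁻¹`, `∫v ≤ C(ρa)^{-1/2}K_ℓ`, `v ≤ ℓ²a⁻⁴`, and `g_v(y) ≤ Cv(x)` for
`|x| ≤ |y|`. [cite: FournaisEtAl2024, Prop. 2.1, (2.4)–(2.5)] -/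
theorem FournaisEtAl2024_prop21_physical (C₀ : ℝ) (hC₀ : 0 < C₀) :
    ∃ C : ℝ, 0 < C ∧ ∀ (V : ℝ → ℝ≥0∞) (R a ρ Kℓ : ℝ), Measurable V → AntitoneOn V (Ioi 0) →
      (∀ r, R < r → V r = 0) → 0 < a → scatteringLength V = ENNReal.ofReal a → R ≤ C₀ * a →
      0 < ρ → 0 < Kℓ → C ≤ Kℓ * (ρ * a ^ 3) ^ (-(1 / 2 : ℝ)) →
      ∃ v : ℝ → ℝ≥0∞, Measurable v ∧ (∀ r, v r ≤ V r) ∧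
        (∀ r, v r ≤ ENNReal.ofReal ((Kℓ * (ρ * a) ^ (-(1 / 2 : ℝ))) ^ 2 / a ^ 4)) ∧
        (∀ r, R < r → v r = 0) ∧
        a - C * a * Real.sqrt (ρ * a ^ 3) / Kℓ ≤ (scatteringLength v).toReal ∧
        scatteringLength v ≤ scatteringLength V ∧
        (∫⁻ x : Space, v ‖x‖) ≤ ENNReal.ofReal (C * (ρ * a) ^ (-(1 / 2 : ℝ)) * Kℓ) ∧
        ∀ x y : ℝ, 0 < x → x ≤ y → (v y).toReal * radialProfile v R y ≤ C * (v x).toReal := by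
  obtain ⟨C, hC, h⟩ := FournaisEtAl2024_prop21 C₀ hC₀
  refine ⟨C, hC, ?_⟩
  intro V R a ρ Kℓ hV hanti hVR ha haV hRa hρ hKℓ hlam
  set lam : ℝ := Kℓ * (ρ * a ^ 3) ^ (-(1 / 2 : ℝ)) with hlam_def
  obtain ⟨v, hmv, hvV, hbv, hvR, hlow, hup, hint, h25⟩ := h V R a lam hV hanti hVR ha haV hRa hlam
  have hρa3 : 0 < ρ * a ^ 3 := by positivity
  have hρa : 0 < ρ * a := by positivity
  -- `(ρa)^{-1/2} = a (ρa³)^{-1/2}`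
  have hpow : (ρ * a) ^ (-(1 / 2 : ℝ)) = a * (ρ * a ^ 3) ^ (-(1 / 2 : ℝ)) := by
    have h1 : ρ * a ^ 3 = (ρ * a) * a ^ 2 := by ring
    rw [h1, Real.mul_rpow hρa.le (sq_nonneg a), show (a ^ 2 : ℝ) = a ^ (2 : ℝ) by norm_cast,
      ← Real.rpow_mul ha.le]
    norm_num
    rw [Real.rpow_neg_one, mul_left_comm, mul_inv_cancel₀ ha.ne', mul_one]
  have hsqrt : (ρ * a ^ 3) ^ (-(1 / 2 : ℝ)) = (Real.sqrt (ρ * a ^ 3))⁻¹ := by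
    rw [Real.rpow_neg hρa3.le, Real.sqrt_eq_rpow]
  have hlam0 : 0 < lam := by rw [hlam_def]; positivity
  -- `λ²/a² = ℓ²/a⁴`
  have hK : lam ^ 2 / a ^ 2 = (Kℓ * (ρ * a) ^ (-(1 / 2 : ℝ))) ^ 2 / a ^ 4 := by
    rw [hpow, hlam_def]; field_simp
  -- `C λ a = C (ρa)^{-1/2} K_ℓ`
  have hint' : C * lam * a = C * (ρ * a) ^ (-(1 / 2 : ℝ)) * Kℓ := by
    rw [hpow, hlam_def]; ring
  -- `a C/λ = C a √(ρa³)/K_ℓ`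
  have hlow' : a * (1 - C / lam) = a - C * a * Real.sqrt (ρ * a ^ 3) / Kℓ := by
    rw [hlam_def, hsqrt]
    have hs : Real.sqrt (ρ * a ^ 3) ≠ 0 := (Real.sqrt_pos.2 hρa3).ne'
    field_simp
  refine ⟨v, hmv, hvV, fun r => hK ▸ hbv r, hvR, hlow' ▸ hlow, hup, hint' ▸ hint, h25⟩

end Prop21

end Literature.MathematicalPhysics.QuantumManyBody.BoseGas
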